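import Literature.NumberTheory.Transcendental.NesterenkoEliminationProp411Cut
import Literature.NumberTheory.Transcendental.NesterenkoSymbolicPowers
import Literature.NumberTheory.Transcendental.NesterenkoEliminationProp47ValuesProofs
import Literature.NumberTheory.Transcendental.NesterenkoEliminationFacts2Proofs
import HarnessLib

/-!
# Towards LNM 1752 Ch. 3 Proposition 4.11, III: the unmixed ideal of the intersection cycle `V(𝔭) · Q` with prescribed multiplicities — proofs only

`Literature/NumberTheory/Transcendental/NesterenkoEliminationProp411Cycle.lean` — proofs only (no
new definitions, nothing asserted). Third step of the discharge of the named fact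
`NesterenkoPhilippon2001_ch3_prop_4_11` (Nesterenko–Philippon (eds.), LNM 1752 (2001), Ch. 3
Prop. 4.11 = [Nes10, Prop. 1.4], the Bézout step). It assembles steps I
(`NesterenkoEliminationProp411Cut.lean`: the minimal primes `𝔮` of `(𝔭, Q)` and the unmixed ideals
`⋂ q_𝔮` supported on them) and II (`NesterenkoSymbolicPowers.lean`: homogeneous `𝔮`-primary
ideals of prescribed exponent) with Proposition 4.4 (the tree's named fact
`NesterenkoPhilippon2001_ch3_prop_4_4`, taken as a hypothesis `h44` exactly as in the proofs of
Prop. 4.7 from Prop. 4.4) into the object the estimates 1)–3) of Prop. 4.11 are about: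

* `exists_cycle_ideal` — let `𝔭 ⊂ ℚ[x₀, …, x_m]` be a homogeneous prime of rank `r`
  (`2 ≤ r ≤ m`), `Q ∉ 𝔭` a form of degree `≥ 1`, `𝓠` the (finite, non-empty) set of minimal primes
  of `(𝔭, Q)` and `e : 𝓠 → ℕ_{≥ 1}` ANY assignment of multiplicities. Then there is a homogeneous
  ideal `J`, unmixed of rank `r − 1`, with `V(J) = V((𝔭, Q))`, whose associated form of index
  `r − 1` is `c · ∏_{𝔮 ∈ 𝓠} F_𝔮^{e_𝔮}` (`c ∈ ℚˣ`, `F_𝔮 = chowForm 𝔮 (r − 1) ≠ 0`), and consequently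
  `deg J = ∑ e_𝔮 deg 𝔮`, `h(J) = h(∏ F_𝔮^{e_𝔮})`, `|J(ω̄)| = |ϰ(∏ F_𝔮^{e_𝔮})| |∏ F_𝔮^{e_𝔮}|⁻¹ |ω̄|^{−(r−1) deg J}`
  (`J = ⋂_𝔮 q_𝔮` with `q_𝔮` the homogeneous core of the symbolic power `𝔮^{(e_𝔮)}`).

With `e_𝔮` the multiplicity of `F_𝔮` in the norm form `a^{deg Q} ∏ₖ Q(β̄⁽ᵏ⁾)` of `Q` over the generic
linear section of `V(𝔭)` this is the `J` of Prop. 4.11 (the cycle `V(𝔭) · Q` in Nesterenko's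
exponent encoding, cf. the module docstring of `NesterenkoSymbolicPowers.lean`); what then remains
of Prop. 4.11 are the three estimates of that norm form.

## References

* [NesterenkoPhilippon2001] Yu. V. Nesterenko, P. Philippon (eds.), *Introduction to Algebraic
  Independence Theory*, LNM 1752, Springer 2001, Ch. 3 §4, Prop. 4.4 (p. 38), Prop. 4.11
  (pp. 40–41; PDF pp. 52–53).
* [Nes10] Yu. V. Nesterenko, Proc. Steklov Inst. Math. 218 (1997) 294–331, Prop. 1.4.
-/

noncomputable section

open MvPolynomial
open Literature.NumberTheory.Transcendental.PhilipponMain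

attribute [local instance] MvPolynomial.gradedAlgebra

namespace Literature.NumberTheory.Transcendental

namespace Nesterenko

variable {m : ℕ}

/-- The invariants of an ideal whose associated form is `c · G`, `c ∈ ℚˣ`: `deg`, `h` and `|·(ω̄)|`
are those of `G`. [cite: NesterenkoPhilippon2001, Ch. 3 Def. 4.5, Def. 4.6 property 1) (pp. 38–39)] -/
theorem invariants_of_chowForm_eq_C_mul {s : ℕ} (hs : 0 < s) {J : Ideal (Rx m)} {c : ℚ} (hc : c ≠ 0)
    {G : RU s m} (hG : chowForm J s = C c * G) :
    ideg J s = blockDeg G ⟨0, hs⟩ ∧ iheight J s = height G ∧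
      ∀ ω : Fin (m + 1) → ℂ,
        iabs J s ω = maxNorm (kappa ω G) / (maxNorm G * ‖ω‖ ^ (s * blockDeg G ⟨0, hs⟩)) := by
  have hdeg : ideg J s = blockDeg G ⟨0, hs⟩ := by
    rw [ideg, dif_pos hs, hG, blockDeg_C_mul hc]
  refine ⟨hdeg, by rw [iheight, hG, height_C_mul hc], fun ω => ?_⟩
  rw [iabs, hdeg, hG, kappa_C_mul', maxNorm_C_mul, maxNorm_C_mul, norm_ratCast_eq]
  have hc' : ‖c‖ ≠ 0 := norm_ne_zero_iff.mpr hc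
  rw [mul_assoc, mul_div_mul_left _ _ hc']

/-- **The unmixed ideal of the cycle `∑ e_𝔮 [V(𝔮)]` over the cut `V(𝔭) ∩ V(Q)`.** Let `𝔭` be a
homogeneous prime of `ℚ[x₀, …, x_m]` of rank `r`, `2 ≤ r ≤ m`, `Q ∉ 𝔭` a form of degree `d ≥ 1`,
`𝓠` the set of minimal primes of `(𝔭, Q)` and `e_𝔮 ≥ 1` (`𝔮 ∈ 𝓠`) integers. Granting
Proposition 4.4, there is a homogeneous ideal `J`, unmixed of rank `r − 1`, with
`V(J) = V((𝔭, Q))` and associated form `chowForm J (r−1) = c ∏_{𝔮 ∈ 𝓠} (chowForm 𝔮 (r−1))^{e_𝔮}`,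
`c ≠ 0`, all `chowForm 𝔮 (r − 1) ≠ 0`; hence `deg J = ∑ e_𝔮 deg 𝔮`.
[cite: NesterenkoPhilippon2001, Ch. 3 Prop. 4.11 (pp. 40–41) with Prop. 4.4 (p. 38)] -/
theorem exists_cycle_ideal (h44 : NesterenkoPhilippon2001_ch3_prop_4_4) {r : ℕ} (hr : 2 ≤ r)
    (hrm : r ≤ m) {𝔭 : Ideal (Rx m)} (h𝔭 : 𝔭.IsPrime)
    (h𝔭hom : 𝔭.IsHomogeneous (homogeneousSubmodule (Fin (m + 1)) ℚ)) (h𝔭unm : IsUnmixedOfRank 𝔭 r)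
    {Q : Rx m} {d : ℕ} (hQ : Q.IsHomogeneous d) (hd : 1 ≤ d) (hQ𝔭 : Q ∉ 𝔭)
    {𝓠 : Finset (Ideal (Rx m))} (h𝓠 : (𝓠 : Set (Ideal (Rx m))) = (𝔭 ⊔ Ideal.span {Q}).minimalPrimes)
    (e : Ideal (Rx m) → ℕ) (he : ∀ 𝔮 ∈ 𝓠, 1 ≤ e 𝔮) :
    ∃ J : Ideal (Rx m), J.IsHomogeneous (homogeneousSubmodule (Fin (m + 1)) ℚ) ∧
      IsUnmixedOfRank J (r - 1) ∧ projZeros J = projZeros (𝔭 ⊔ Ideal.span {Q}) ∧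
      J.associatedPrimes = (𝔭 ⊔ Ideal.span {Q}).minimalPrimes ∧
      (∀ 𝔮 ∈ 𝓠, chowForm 𝔮 (r - 1) ≠ 0) ∧
      (∃ c : ℚ, c ≠ 0 ∧
        chowForm J (r - 1) = C c * ∏ 𝔮 ∈ 𝓠, chowForm 𝔮 (r - 1) ^ e 𝔮) ∧
      ideg J (r - 1) = ∑ 𝔮 ∈ 𝓠, e 𝔮 * ideg 𝔮 (r - 1) := by
  classical
  have hmem : ∀ 𝔮 ∈ 𝓠, 𝔮 ∈ (𝔭 ⊔ Ideal.span {Q}).minimalPrimes := fun 𝔮 h𝔮 => by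
    rw [← h𝓠]; exact Finset.mem_coe.mpr h𝔮
  have hfacts := fun 𝔮 (h𝔮 : 𝔮 ∈ 𝓠) =>
    minimalPrimes_cut_facts (by omega) h𝔭 h𝔭hom h𝔭unm hQ hQ𝔭 (hmem 𝔮 h𝔮)
  -- the minimal primes are non-zero (they contain `Q ≠ 0`)
  have hQ0 : Q ≠ 0 := fun h => hQ𝔭 (h ▸ 𝔭.zero_mem)
  have hne0 : ∀ 𝔮 ∈ 𝓠, 𝔮 ≠ ⊥ := fun 𝔮 h𝔮 h =>
    hQ0 (by simpa [h] using (hfacts 𝔮 h𝔮).2.2.2.2.2)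
  -- the components `q 𝔮`: homogeneous `𝔮`-primary of exponent `e 𝔮`
  have hex : ∀ 𝔮 ∈ 𝓠, ∃ q : Ideal (Rx m), q.IsPrimary ∧ q.radical = 𝔮 ∧
      q.IsHomogeneous (homogeneousSubmodule (Fin (m + 1)) ℚ) ∧ 𝔮 ^ e 𝔮 ≤ q ∧ q ≤ 𝔮 ∧
      primaryExponent q = e 𝔮 := fun 𝔮 h𝔮 =>
    exists_homogeneous_primary_exponent_eq (hfacts 𝔮 h𝔮).1 (hfacts 𝔮 h𝔮).2.1 (hne0 𝔮 h𝔮)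
      (he 𝔮 h𝔮)
  choose! q hq using hex
  set J : Ideal (Rx m) := 𝓠.inf q with hJ
  obtain ⟨hJhom, hJunm, hJV, hJass⟩ := cut_inf_facts hr h𝔭 h𝔭hom h𝔭unm hQ hd hQ𝔭 h𝓠 q
    fun 𝔮 h𝔮 => ⟨(hq 𝔮 h𝔮).1, (hq 𝔮 h𝔮).2.1, (hq 𝔮 h𝔮).2.2.1⟩
  -- the reduced primary decomposition `{q 𝔮}` of `J`
  have hprime : ∀ 𝔮 ∈ 𝓠, 𝔮.IsPrime := fun 𝔮 h𝔮 => (hfacts 𝔮 h𝔮).1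
  have hdim : ∀ 𝔮 ∈ 𝓠, ringKrullDim (Rx m ⧸ 𝔮) = (r - 1 : ℕ) := fun 𝔮 h𝔮 => (hfacts 𝔮 h𝔮).2.2.1
  have ht : Submodule.IsMinimalPrimaryDecomposition J (𝓠.image q) :=
    isMinimalPrimaryDecomposition_image hprime (incomparable_of_ringKrullDim_eq hprime hdim) q
      fun 𝔮 h𝔮 => ⟨(hq 𝔮 h𝔮).1, (hq 𝔮 h𝔮).2.1⟩
  have hqinj : Set.InjOn q 𝓠 := fun 𝔮 h𝔮 𝔮' h𝔮' h => by
    rw [← (hq 𝔮 h𝔮).2.1, ← (hq 𝔮' h𝔮').2.1, h]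
  -- Proposition 4.4 for `J`
  obtain ⟨hne, c, hc, hprod⟩ :=
    exists_chowForm_eq_C_mul_prod h44 (r := r - 1) (by omega) (by omega) hJhom hJunm ht
  have hdegsum := sum_primaryExponent_mul_ideg_eq h44 (r := r - 1) (by omega) (by omega) hJhom hJunm ht
  rw [Finset.prod_image hqinj] at hprod
  rw [Finset.sum_image hqinj] at hdegsum
  have hprod' : chowForm J (r - 1) = C c * ∏ 𝔮 ∈ 𝓠, chowForm 𝔮 (r - 1) ^ e 𝔮 := by
    rw [hprod]
    congr 1
    refine Finset.prod_congr rfl fun 𝔮 h𝔮 => ?_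
    rw [(hq 𝔮 h𝔮).2.1, (hq 𝔮 h𝔮).2.2.2.2.2]
  have hdeg' : ideg J (r - 1) = ∑ 𝔮 ∈ 𝓠, e 𝔮 * ideg 𝔮 (r - 1) := by
    rw [← hdegsum]
    refine Finset.sum_congr rfl fun 𝔮 h𝔮 => ?_
    rw [(hq 𝔮 h𝔮).2.1, (hq 𝔮 h𝔮).2.2.2.2.2]
  have hne' : ∀ 𝔮 ∈ 𝓠, chowForm 𝔮 (r - 1) ≠ 0 := fun 𝔮 h𝔮 => by
    have h := hne (q 𝔮) (Finset.mem_image_of_mem q h𝔮)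
    rwa [(hq 𝔮 h𝔮).2.1] at h
  exact ⟨J, hJhom, hJunm, hJV, hJass, hne', ⟨c, hc, hprod'⟩, hdeg'⟩

/-- The same, with the invariants of `J` read off from the form `G = ∏ F_𝔮^{e_𝔮}`:
`deg J = deg_{u₁} G`, `h(J) = h(G)`, `|J(ω̄)| = |ϰ(G)| · |G|⁻¹ · |ω̄|^{−(r−1) deg_{u₁} G}` — so that the
estimates 1)–3) of Prop. 4.11 for `J` are estimates of `G`.
[cite: NesterenkoPhilippon2001, Ch. 3 Prop. 4.11 (pp. 40–41)] -/
theorem exists_cycle_ideal_invariants (h44 : NesterenkoPhilippon2001_ch3_prop_4_4) {r : ℕ}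
    (hr : 2 ≤ r) (hrm : r ≤ m) {𝔭 : Ideal (Rx m)} (h𝔭 : 𝔭.IsPrime)
    (h𝔭hom : 𝔭.IsHomogeneous (homogeneousSubmodule (Fin (m + 1)) ℚ)) (h𝔭unm : IsUnmixedOfRank 𝔭 r)
    {Q : Rx m} {d : ℕ} (hQ : Q.IsHomogeneous d) (hd : 1 ≤ d) (hQ𝔭 : Q ∉ 𝔭)
    {𝓠 : Finset (Ideal (Rx m))} (h𝓠 : (𝓠 : Set (Ideal (Rx m))) = (𝔭 ⊔ Ideal.span {Q}).minimalPrimes)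
    (e : Ideal (Rx m) → ℕ) (he : ∀ 𝔮 ∈ 𝓠, 1 ≤ e 𝔮) (hs : 0 < r - 1) :
    ∃ (J : Ideal (Rx m)) (c : ℚ), J.IsHomogeneous (homogeneousSubmodule (Fin (m + 1)) ℚ) ∧
      IsUnmixedOfRank J (r - 1) ∧ projZeros J = projZeros (𝔭 ⊔ Ideal.span {Q}) ∧ c ≠ 0 ∧
      chowForm J (r - 1) = C c * ∏ 𝔮 ∈ 𝓠, chowForm 𝔮 (r - 1) ^ e 𝔮 ∧
      ideg J (r - 1) = blockDeg (∏ 𝔮 ∈ 𝓠, chowForm 𝔮 (r - 1) ^ e 𝔮) ⟨0, hs⟩ ∧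
      iheight J (r - 1) = height (∏ 𝔮 ∈ 𝓠, chowForm 𝔮 (r - 1) ^ e 𝔮) ∧
      ∀ ω : Fin (m + 1) → ℂ, iabs J (r - 1) ω =
        maxNorm (kappa ω (∏ 𝔮 ∈ 𝓠, chowForm 𝔮 (r - 1) ^ e 𝔮)) /
          (maxNorm (∏ 𝔮 ∈ 𝓠, chowForm 𝔮 (r - 1) ^ e 𝔮) *
            ‖ω‖ ^ ((r - 1) * blockDeg (∏ 𝔮 ∈ 𝓠, chowForm 𝔮 (r - 1) ^ e 𝔮) ⟨0, hs⟩)) := by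
  obtain ⟨J, hJhom, hJunm, hJV, -, -, ⟨c, hc, hprod⟩, -⟩ :=
    exists_cycle_ideal h44 hr hrm h𝔭 h𝔭hom h𝔭unm hQ hd hQ𝔭 h𝓠 e he
  obtain ⟨h1, h2, h3⟩ := invariants_of_chowForm_eq_C_mul hs hc hprod
  exact ⟨J, c, hJhom, hJunm, hJV, hc, hprod, h1, h2, h3⟩

end Nesterenko

end Literature.NumberTheory.Transcendental

end
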